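import Mathlib
import Literature.Probability.LatticeModels.ConformalCovariance
import Summits.CriticalPhenomena.Ising3DConformalLimit.Theorems.PrecisionLaplacianMoebiusLimitOfTwoPointLawSCTOfWardAux
import HarnessLib

/-!
# Stub A of line `multipole-ward-nonsat-endpoint` (crux `MoebiusLimitOfTwoPointLaw`, item stmt-CriticalPhenomena-4801):
# the weak special-conformal Ward identity integrates to finite SCT covariance

`stub_sctOfWard` (registered): if `S_n` vanishes off `NonCoincident`, is continuous on it, and satisfies the weak
`K_b`-identity `∫ S_n [(2Δ−6)(Σ⟪b,xᵢ⟫)φ + Dφ·(‖xᵢ‖²b − 2⟪b,xᵢ⟫xᵢ)ᵢ] = 0` for all smooth tests `φ` compactly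
supported in `NonCoincident` (the hypothesis of item 5357 `PrimaryAtInfinity.WardToMoebius`), then for every `a`
and every off-origin configuration `x` whose SCT path is pole-free,
`S_n(SCT_a x) = ∏ (1 + 2⟪a,xᵢ⟫ + ‖a‖²‖xᵢ‖²)^Δ S_n(x)`, `SCT_a x = (x + ‖x‖²a)/(1 + 2⟪a,x⟫ + ‖a‖²‖x‖²)`.

Mechanism (`K = ιPι`): by the landed helper `sctA_weak_translation` (file `…SCTOfWardAux.lean`) the family
`T(y) = (∏ (‖yⱼ‖²)^(−Δ)) S_n(Φ y)` (`Φ` = coordinatewise unit inversion) satisfies the weak TRANSLATION identity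
`∫ T · Dψ[(a,…,a)] = 0` on the off-origin non-coincident configurations; `sctB_segment_invariance` integrates it
along segments (differentiation under the integral sign, constancy on an interval, the fundamental lemma of the
calculus of variations `IsOpen.ae_eq_zero_of_integral_contDiff_smul_eq_zero`, continuity); reading
`T(Φx + a) = T(Φx)` back through `Φ` (`ι(ιx + a) = SCT_a x`, `‖ιx + a‖² = σ_a(x)/‖x‖²`) gives the claim.

References: Di Francesco–Mathieu–Sénéchal 1997 §4.1–4.3 [FrancescoMathieuSenechal1997]; Hörmander, ALPDO I,
Thm 1.2.5 [HormanderALPDO1].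
-/

noncomputable section

namespace Summit.CriticalPhenomena.Ising3DConformalLimit.PrecisionLaplacianMoebiusLimitOfTwoPointLaw

open Literature.Probability.LatticeModels Filter Topology MeasureTheory Set Metric
open Summit.CriticalPhenomena.Ising3DConformalLimit.Theorems.MoebiusLimitOfTwoPointLaw.Negative
  (norm_sphereInversion sphereInversion_injective)

/-! ## A weak translation identity integrates along segments -/

/-- A product `T · g` with `T` continuous on an open set `U` and `g` continuous, vanishing off a compact
subset of `U`, is continuous. -/
theorem sctB_continuous_mul_of_compact {n : ℕ} {U : Set (Fin n → EuclideanSpace ℝ (Fin 3))}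
    (hU : IsOpen U) {T g : (Fin n → EuclideanSpace ℝ (Fin 3)) → ℝ} (hT : ContinuousOn T U)
    (hg : Continuous g) {K : Set (Fin n → EuclideanSpace ℝ (Fin 3))} (hK : IsCompact K) (hKU : K ⊆ U)
    (hgK : ∀ z, z ∉ K → g z = 0) : Continuous fun z => T z * g z := by
  refine continuous_iff_continuousAt.2 fun z => ?_
  by_cases hz : z ∈ U
  · exact (hT.continuousAt (hU.mem_nhds hz)).mul hg.continuousAt
  · have hzK : z ∉ K := fun h => hz (hKU h)
    have hev : (fun w => T w * g w) =ᶠ[𝓝 z] fun _ => 0 := by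
      filter_upwards [hK.isClosed.isOpen_compl.mem_nhds hzK] with w hw
      rw [hgK w hw, mul_zero]
    exact (continuousAt_const.congr hev.symm)

/-- **Segment integration of a weak translation identity.** Let `U` be open, `T` continuous on `U`, and
suppose `∫ T(z) Dψ(z)[v] dz = 0` for every smooth `ψ` compactly supported in `U`. If the segment
`{y + t v : t ∈ [0,1]}` lies in `U`, then `T(y + v) = T(y)`. -/
theorem sctB_segment_invariance {n : ℕ} {U : Set (Fin n → EuclideanSpace ℝ (Fin 3))} (hU : IsOpen U)
    {T : (Fin n → EuclideanSpace ℝ (Fin 3)) → ℝ} (hT : ContinuousOn T U) (v : Fin n → EuclideanSpace ℝ (Fin 3))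
    (hP : ∀ ψ : (Fin n → EuclideanSpace ℝ (Fin 3)) → ℝ, ContDiff ℝ ((⊤ : ℕ∞) : WithTop ℕ∞) ψ →
      HasCompactSupport ψ → tsupport ψ ⊆ U → ∫ z, T z * fderiv ℝ ψ z v = 0)
    {y : Fin n → EuclideanSpace ℝ (Fin 3)} (hseg : ∀ t ∈ Icc (0 : ℝ) 1, y + t • v ∈ U) :
    T (y + v) = T y := by
  -- room around the segment
  set Kseg : Set (Fin n → EuclideanSpace ℝ (Fin 3)) := (fun t : ℝ => y + t • v) '' Icc (0 : ℝ) 1 with hKseg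
  have hKc : IsCompact Kseg := isCompact_Icc.image (by fun_prop)
  have hKU : Kseg ⊆ U := by rintro _ ⟨t, ht, rfl⟩; exact hseg t ht
  obtain ⟨δ, hδ, hδU⟩ := hKc.exists_cthickening_subset_open hU hKU
  have hroom : ∀ t ∈ Icc (0 : ℝ) 1, ∀ z, dist z (y + t • v) ≤ δ → z ∈ U := fun t ht z hz =>
    hδU (Metric.mem_cthickening_of_dist_le z (y + t • v) δ Kseg ⟨t, ht, rfl⟩ hz)
  -- the slightly enlarged parameter interval
  set η : ℝ := δ / (2 * (‖v‖ + 1)) with hη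
  have hηpos : 0 < η := by positivity
  have hηv : η * ‖v‖ ≤ δ / 2 := by
    rw [hη, div_mul_eq_mul_div, div_le_div_iff₀ (by positivity) (by positivity)]
    nlinarith [norm_nonneg v, hδ]
  -- translates of points near `y` by `t v`, `t ∈ [-η, 1+η]`, stay in `U`
  have hshift : ∀ t ∈ Icc (-η) (1 + η), ∀ w, dist w y < δ / 2 → w + t • v ∈ U := by
    intro t ht w hw
    set t' : ℝ := max 0 (min t 1) with ht'
    have ht'I : t' ∈ Icc (0 : ℝ) 1 := ⟨le_max_left _ _, max_le zero_le_one (min_le_right _ _)⟩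
    have htt' : |t - t'| ≤ η := by
      rcases le_total t 0 with h0 | h0
      · have : t' = 0 := by rw [ht', min_eq_left (h0.trans zero_le_one), max_eq_left h0]
        rw [this, sub_zero, abs_of_nonpos h0]; linarith [ht.1]
      rcases le_total t 1 with h1 | h1
      · have : t' = t := by rw [ht', min_eq_left h1, max_eq_right h0]
        rw [this, sub_self, abs_zero]; exact hηpos.le
      · have : t' = 1 := by rw [ht', min_eq_right h1, max_eq_right zero_le_one]
        rw [this, abs_of_nonneg (by linarith)]; linarith [ht.2]
    refine hroom t' ht'I _ ?_
    calc dist (w + t • v) (y + t' • v)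
        ≤ dist (w + t • v) (w + t' • v) + dist (w + t' • v) (y + t' • v) := dist_triangle _ _ _
      _ = |t - t'| * ‖v‖ + dist w y := by
          rw [dist_eq_norm, dist_eq_norm, dist_eq_norm, add_sub_add_left_eq_sub, ← sub_smul, norm_smul,
            Real.norm_eq_abs, add_sub_add_right_eq_sub]
      _ ≤ η * ‖v‖ + δ / 2 := add_le_add (mul_le_mul_of_nonneg_right htt' (norm_nonneg _)) hw.le
      _ ≤ δ := by linarith
  -- Step 1: for test functions supported in the ball of radius δ/2 about y, the pairing is translation invariant
  have hpair : ∀ ψ : (Fin n → EuclideanSpace ℝ (Fin 3)) → ℝ, ContDiff ℝ ((⊤ : ℕ∞) : WithTop ℕ∞) ψ →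
      HasCompactSupport ψ → tsupport ψ ⊆ ball y (δ / 2) →
      ∫ z, T z * ψ (z - v) = ∫ z, T z * ψ z := by
    intro ψ hψ hψc hψs
    have hψd : Differentiable ℝ ψ := hψ.differentiable (by simp)
    -- bounds
    obtain ⟨Mψ, hMψ⟩ := (hψ.continuous_fderiv (by simp)).bounded_above_of_compact_support (hψc.fderiv ℝ)
    set C : Set (Fin n → EuclideanSpace ℝ (Fin 3)) :=
      (fun p : ℝ × (Fin n → EuclideanSpace ℝ (Fin 3)) => p.2 + p.1 • v) '' (Icc (-η) (1 + η) ×ˢ tsupport ψ)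
      with hC
    have hCc : IsCompact C := (isCompact_Icc.prod hψc).image (by fun_prop)
    have hCU : C ⊆ U := by
      rintro _ ⟨⟨t, w⟩, ⟨ht, hw⟩, rfl⟩
      exact hshift t ht w (mem_ball.1 (hψs hw))
    obtain ⟨MT, hMT⟩ := hCc.exists_bound_of_continuousOn (hT.mono hCU)
    -- membership in C
    have hmemC : ∀ t ∈ Icc (-η) (1 + η), ∀ z, ψ (z - t • v) ≠ 0 ∨ fderiv ℝ ψ (z - t • v) ≠ 0 → z ∈ C := by
      intro t ht z hz
      have hz' : z - t • v ∈ tsupport ψ := by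
        rcases hz with h | h
        · exact subset_tsupport _ h
        · by_contra h'
          exact h (fderiv_of_notMem_tsupport ℝ h')
      exact ⟨⟨t, z - t • v⟩, ⟨ht, hz'⟩, by simp⟩
    -- the parametrised integrand and its derivative
    set F : ℝ → (Fin n → EuclideanSpace ℝ (Fin 3)) → ℝ := fun t z => T z * ψ (z - t • v) with hF
    set F' : ℝ → (Fin n → EuclideanSpace ℝ (Fin 3)) → ℝ :=
      fun t z => T z * -(fderiv ℝ ψ (z - t • v) v) with hF'
    have hIoo : Ioo (-η) (1 + η) ⊆ Icc (-η) (1 + η) := Ioo_subset_Icc_self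
    have hFcont : ∀ t ∈ Icc (-η) (1 + η), Continuous (F t) := by
      intro t ht
      refine sctB_continuous_mul_of_compact hU hT (hψ.continuous.comp (by fun_prop)) hCc hCU fun z hz => ?_
      by_contra h
      exact hz (hmemC t ht z (Or.inl h))
    have hF'cont : ∀ t ∈ Icc (-η) (1 + η), Continuous (F' t) := by
      intro t ht
      have hc : Continuous fun z : Fin n → EuclideanSpace ℝ (Fin 3) => -(fderiv ℝ ψ (z - t • v) v) :=
        (((hψ.continuous_fderiv (by simp)).comp (by fun_prop)).clm_apply continuous_const).neg
      refine sctB_continuous_mul_of_compact hU hT hc hCc hCU fun z hz => ?_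
      by_contra h
      exact hz (hmemC t ht z (Or.inr fun h' => h (by rw [h', _root_.zero_apply, neg_zero])))
    have hFsupp : ∀ t ∈ Icc (-η) (1 + η), ∀ z, z ∉ C → F t z = 0 := by
      intro t ht z hz
      have : ψ (z - t • v) = 0 := by by_contra h; exact hz (hmemC t ht z (Or.inl h))
      simp only [hF, this, mul_zero]
    have hderiv : ∀ t₀ ∈ Ioo (-η) (1 + η), HasDerivAt (fun t => ∫ z, F t z) (∫ z, F' t₀ z) t₀ := by
      intro t₀ ht₀
      have hs : Ioo (-η) (1 + η) ∈ 𝓝 t₀ := isOpen_Ioo.mem_nhds ht₀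
      refine (hasDerivAt_integral_of_dominated_loc_of_deriv_le (μ := volume)
        (bound := C.indicator fun _ => |MT| * (Mψ * ‖v‖)) hs ?_ ?_ ?_ ?_ ?_ ?_).2
      · filter_upwards [hs] with t ht
        exact (hFcont t (hIoo ht)).aestronglyMeasurable
      · exact (hFcont t₀ (hIoo ht₀)).integrable_of_hasCompactSupport
          (HasCompactSupport.intro hCc (hFsupp t₀ (hIoo ht₀)))
      · exact (hF'cont t₀ (hIoo ht₀)).aestronglyMeasurable
      · refine Filter.Eventually.of_forall fun z t ht => ?_
        by_cases hz : z ∈ C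
        · rw [indicator_of_mem hz]
          simp only [hF', norm_mul, norm_neg, Real.norm_eq_abs]
          have h1 : |T z| ≤ |MT| := (Real.norm_eq_abs (T z) ▸ hMT z hz).trans (le_abs_self MT)
          have h2 : |fderiv ℝ ψ (z - t • v) v| ≤ Mψ * ‖v‖ := by
            rw [← Real.norm_eq_abs]
            exact (ContinuousLinearMap.le_opNorm _ _).trans (mul_le_mul_of_nonneg_right (hMψ _) (norm_nonneg _))
          exact mul_le_mul h1 h2 (abs_nonneg _) (abs_nonneg _)
        · rw [indicator_of_notMem hz]
          have h1 : fderiv ℝ ψ (z - t • v) = 0 := by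
            by_contra h; exact hz (hmemC t (hIoo ht) z (Or.inr h))
          simp [hF', h1]
      · exact (integrableOn_const (hCc.measure_lt_top (μ := volume)).ne).integrable_indicator
          hCc.measurableSet
      · refine Filter.Eventually.of_forall fun z t _ => ?_
        have h1 : HasDerivAt (fun t : ℝ => z - t • v) (-((1 : ℝ) • v)) t :=
          ((hasDerivAt_id t).smul_const v).const_sub z
        have h2 := ((hψd (z - t • v)).hasFDerivAt.comp_hasDerivAt t h1).const_mul (T z)
        simpa [hF', one_smul] using h2
    -- the derivative vanishes by the weak identity applied to the translated test function
    have hderiv0 : ∀ t₀ ∈ Ioo (-η) (1 + η), ∫ z, F' t₀ z = 0 := by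
      intro t₀ ht₀
      have hψt : ContDiff ℝ ((⊤ : ℕ∞) : WithTop ℕ∞) fun z : Fin n → EuclideanSpace ℝ (Fin 3) => ψ (z - t₀ • v) :=
        hψ.comp (contDiff_id.sub contDiff_const)
      have hψtc : HasCompactSupport fun z : Fin n → EuclideanSpace ℝ (Fin 3) => ψ (z - t₀ • v) :=
        hψc.comp_homeomorph (Homeomorph.subRight (t₀ • v))
      have hψts : tsupport (fun z : Fin n → EuclideanSpace ℝ (Fin 3) => ψ (z - t₀ • v)) ⊆ U := by
        refine (closure_minimal (fun z hz => ?_) hCc.isClosed).trans hCU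
        exact hmemC t₀ (hIoo ht₀) z (Or.inl hz)
      have key := hP _ hψt hψtc hψts
      have hfd : ∀ z, fderiv ℝ (fun z : Fin n → EuclideanSpace ℝ (Fin 3) => ψ (z - t₀ • v)) z v =
          fderiv ℝ ψ (z - t₀ • v) v := by
        intro z
        have h : HasFDerivAt (fun z : Fin n → EuclideanSpace ℝ (Fin 3) => ψ (z - t₀ • v))
            ((fderiv ℝ ψ (z - t₀ • v)).comp (ContinuousLinearMap.id ℝ _)) z :=
          (hψd (z - t₀ • v)).hasFDerivAt.comp z ((hasFDerivAt_id z).sub_const (t₀ • v))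
        rw [h.fderiv]
        rfl
      simp only [hfd] at key
      simp only [hF', mul_neg, integral_neg, key, neg_zero]
    -- constancy on the open interval, evaluated at 0 and 1
    have hdiff : DifferentiableOn ℝ (fun t => ∫ z, F t z) (Ioo (-η) (1 + η)) :=
      fun t ht => (hderiv t ht).differentiableAt.differentiableWithinAt
    have hconst := isOpen_Ioo.is_const_of_deriv_eq_zero isPreconnected_Ioo hdiff
      (fun t ht => by rw [(hderiv t ht).deriv, hderiv0 t ht]; rfl)
      (show (1 : ℝ) ∈ Ioo (-η) (1 + η) from ⟨by linarith, by linarith⟩)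
      (show (0 : ℝ) ∈ Ioo (-η) (1 + η) from ⟨by linarith, by linarith⟩)
    simpa [hF] using hconst
  -- Step 2: the fundamental lemma on the ball
  have hBall : ∀ z ∈ ball y (δ / 2), z ∈ U ∧ z + v ∈ U := by
    intro z hz
    refine ⟨?_, ?_⟩
    · simpa using hshift 0 ⟨by linarith, by linarith⟩ z (mem_ball.1 hz)
    · simpa using hshift 1 ⟨by linarith, by linarith⟩ z (mem_ball.1 hz)
  have hcont1 : ContinuousOn (fun z => T (z + v)) (ball y (δ / 2)) :=
    hT.comp (by fun_prop) fun z hz => (hBall z hz).2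
  have hcont2 : ContinuousOn T (ball y (δ / 2)) := hT.mono fun z hz => (hBall z hz).1
  have hcont : ContinuousOn (fun z => T (z + v) - T z) (ball y (δ / 2)) := hcont1.sub hcont2
  have hUv : IsOpen {z : Fin n → EuclideanSpace ℝ (Fin 3) | z + v ∈ U} := hU.preimage (by fun_prop)
  have hTv : ContinuousOn (fun z => T (z + v)) {z : Fin n → EuclideanSpace ℝ (Fin 3) | z + v ∈ U} :=
    hT.comp (by fun_prop) fun z hz => hz
  have hae := (isOpen_ball (x := y) (ε := δ / 2)).ae_eq_zero_of_integral_contDiff_smul_eq_zero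
    (μ := volume) (hcont.locallyIntegrableOn measurableSet_ball) fun g hg hgc hgs => by
      have h1 := hpair g hg hgc hgs
      have hg0 : ∀ z, z ∉ tsupport g → g z = 0 := fun z hz => image_eq_zero_of_notMem_tsupport hz
      have hI1 : Integrable (fun z => T (z + v) * g z) volume :=
        (sctB_continuous_mul_of_compact hUv hTv hg.continuous hgc (fun z hz => (hBall z (hgs hz)).2)
          hg0).integrable_of_hasCompactSupport hgc.mul_left
      have hI2 : Integrable (fun z => T z * g z) volume :=
        (sctB_continuous_mul_of_compact hU hT hg.continuous hgc (fun z hz => (hBall z (hgs hz)).1)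
          hg0).integrable_of_hasCompactSupport hgc.mul_left
      have h2 : ∫ z, T (z + v) * g z = ∫ z, T z * g (z - v) := by
        rw [← integral_add_right_eq_self (fun z => T z * g (z - v)) v]
        simp
      calc ∫ z, g z • (T (z + v) - T z) = ∫ z, (T (z + v) * g z - T z * g z) := by
            congr 1; funext z; rw [smul_eq_mul]; ring
        _ = (∫ z, T (z + v) * g z) - ∫ z, T z * g z := integral_sub hI1 hI2
        _ = 0 := by rw [h2, h1, sub_self]
  have heq : EqOn (fun z => T (z + v) - T z) 0 (ball y (δ / 2)) :=
    Measure.eqOn_open_of_ae_eq ((ae_restrict_iff' measurableSet_ball).2 hae) isOpen_ball hcont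
      continuousOn_const
  have := heq (mem_ball_self (by positivity))
  simpa [sub_eq_zero] using this

/-! ## The registered stub -/

/-- Rpow bookkeeping for the read-back: `(σ/r)^(−Δ) = (σ^Δ)⁻¹ · (1/r)^(−Δ)` for `σ, r > 0`. -/
theorem sctB_rpow_bookkeeping {σ r Δ : ℝ} (hσ : 0 < σ) (hr : 0 < r) :
    (σ / r) ^ (-Δ) = (σ ^ Δ)⁻¹ * (1 / r) ^ (-Δ) := by
  rw [Real.div_rpow hσ.le hr.le, Real.div_rpow zero_le_one hr.le, Real.one_rpow, Real.rpow_neg hσ.le]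
  ring

/-- **Stub A (`stub_sctOfWard`).** The weak special-conformal Ward identity integrates to covariance under the
finite special conformal maps along pole-free paths (see the module docstring). -/
theorem stub_sctOfWard :
    ∀ (S : CorrFamily 3) (Δ : ℝ), (∀ n z, z ∉ NonCoincident 3 n → S n z = 0) →
      (∀ n, ContinuousOn (S n) (NonCoincident 3 n)) →
      (∀ (n : ℕ) (b : EuclideanSpace ℝ (Fin 3)) (φ : (Fin n → EuclideanSpace ℝ (Fin 3)) → ℝ),
        ContDiff ℝ ((⊤ : ℕ∞) : WithTop ℕ∞) φ → HasCompactSupport φ → tsupport φ ⊆ NonCoincident 3 n →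
        ∫ x, S n x * ((2 * Δ - 6) * (∑ i, inner ℝ b (x i)) * φ x +
          fderiv ℝ φ x (fun i => ‖x i‖ ^ 2 • b - (2 * inner ℝ b (x i)) • x i)) = 0) →
      ∀ (n : ℕ) (a : EuclideanSpace ℝ (Fin 3)) (x : Fin n → EuclideanSpace ℝ (Fin 3)), (∀ i, x i ≠ 0) →
        (∀ i, ∀ s ∈ Set.Icc (0 : ℝ) 1, 1 + 2 * s * inner ℝ a (x i) + s ^ 2 * ‖a‖ ^ 2 * ‖x i‖ ^ 2 ≠ 0) →
        S n (fun i => (1 + 2 * inner ℝ a (x i) + ‖a‖ ^ 2 * ‖x i‖ ^ 2)⁻¹ • (x i + ‖x i‖ ^ 2 • a)) =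
          (∏ i, (1 + 2 * inner ℝ a (x i) + ‖a‖ ^ 2 * ‖x i‖ ^ 2) ^ Δ) * S n x := by
  intro S Δ hnorm hcont hK n a x hx0 hpole
  -- the denominators are positive
  have hσne : ∀ i, 1 + 2 * inner ℝ a (x i) + ‖a‖ ^ 2 * ‖x i‖ ^ 2 ≠ 0 := fun i => by
    simpa using hpole i 1 ⟨zero_le_one, le_rfl⟩
  have hσpos : ∀ i, 0 < 1 + 2 * inner ℝ a (x i) + ‖a‖ ^ 2 * ‖x i‖ ^ 2 :=
    fun i => sctA_sigma_pos (hx0 i) (hσne i)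
  have hr : ∀ i, (0 : ℝ) < ‖x i‖ ^ 2 := fun i => by have := norm_pos_iff.2 (hx0 i); positivity
  by_cases hxN : x ∈ NonCoincident 3 n
  swap
  · -- coincident configurations: both sides vanish (`SCT_a` preserves coincidences)
    have h1 : (fun i => (1 + 2 * inner ℝ a (x i) + ‖a‖ ^ 2 * ‖x i‖ ^ 2)⁻¹ • (x i + ‖x i‖ ^ 2 • a)) ∉
        NonCoincident 3 n := by
      intro h
      apply hxN
      rw [mem_nonCoincident] at h ⊢
      intro i j hij
      exact h (by simp only [hij])
    rw [hnorm n _ h1, hnorm n x hxN, mul_zero]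
  -- the open set of off-origin non-coincident configurations and the family `T`
  have hU : IsOpen ({y : Fin n → EuclideanSpace ℝ (Fin 3) | ∀ i, y i ≠ 0} ∩ NonCoincident 3 n) :=
    (isOpen_forall_ne_zero n).inter (isOpen_nonCoincident 3 n)
  have hT : ContinuousOn (fun y : Fin n → EuclideanSpace ℝ (Fin 3) =>
      (∏ j, (‖y j‖ ^ 2) ^ (-Δ)) * S n (fun i => (1 / ‖y i‖ ^ 2) • y i))
      ({y | ∀ i, y i ≠ 0} ∩ NonCoincident 3 n) := by
    refine ((sctA_continuousOn_weight n (-Δ)).mono inter_subset_left).mul ?_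
    refine (hcont n).comp ((sctA_continuousOn_prodInv n).mono inter_subset_left) fun y hy => ?_
    exact sctA_prodInv_mem_nonCoincident hy.2
  have hP : ∀ ψ : (Fin n → EuclideanSpace ℝ (Fin 3)) → ℝ, ContDiff ℝ ((⊤ : ℕ∞) : WithTop ℕ∞) ψ →
      HasCompactSupport ψ → tsupport ψ ⊆ {y | ∀ i, y i ≠ 0} ∩ NonCoincident 3 n →
      ∫ z, (fun y : Fin n → EuclideanSpace ℝ (Fin 3) =>
        (∏ j, (‖y j‖ ^ 2) ^ (-Δ)) * S n (fun i => (1 / ‖y i‖ ^ 2) • y i)) z *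
        fderiv ℝ ψ z (fun _ => a) = 0 :=
    fun ψ hψ hψc hψs => sctA_weak_translation S Δ n a (hK n) ψ hψ hψc
      (hψs.trans inter_subset_left) (hψs.trans inter_subset_right)
  -- the segment from `Φ x` to `Φ x + (a,…,a)` stays inside
  have hnormsq : ∀ i, ∀ t : ℝ, ‖(1 / ‖x i‖ ^ 2) • x i + t • a‖ ^ 2 =
      (1 + 2 * t * inner ℝ a (x i) + t ^ 2 * ‖a‖ ^ 2 * ‖x i‖ ^ 2) / ‖x i‖ ^ 2 := by
    intro i t
    rw [sctA_norm_sq_inv_add (hx0 i) (t • a), real_inner_smul_left, norm_smul, Real.norm_eq_abs, mul_pow,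
      sq_abs]
    ring
  have hseg : ∀ t ∈ Icc (0 : ℝ) 1, (fun i => (1 / ‖x i‖ ^ 2) • x i) + t • (fun _ : Fin n => a) ∈
      {y : Fin n → EuclideanSpace ℝ (Fin 3) | ∀ i, y i ≠ 0} ∩ NonCoincident 3 n := by
    intro t ht
    refine ⟨fun i h0 => ?_, ?_⟩
    · have h1 : ‖(1 / ‖x i‖ ^ 2) • x i + t • a‖ ^ 2 = 0 := by
        have : ((fun i => (1 / ‖x i‖ ^ 2) • x i) + t • (fun _ : Fin n => a)) i =
            (1 / ‖x i‖ ^ 2) • x i + t • a := rfl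
        rw [← this, h0, norm_zero, zero_pow two_ne_zero]
      rw [hnormsq i t, div_eq_zero_iff] at h1
      rcases h1 with h1 | h1
      · exact hpole i t ht h1
      · exact (hr i).ne' h1
    · rw [mem_nonCoincident]
      intro i j hij
      have hij' : (1 / ‖x i‖ ^ 2) • x i + t • a = (1 / ‖x j‖ ^ 2) • x j + t • a := hij
      exact (mem_nonCoincident x).1 hxN (sphereInversion_injective one_ne_zero (add_right_cancel hij'))
  have key := sctB_segment_invariance hU hT (fun _ => a) hP hseg
  simp only [Pi.add_apply] at key
  -- read the identity back through `Φ`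
  have e1 : (fun i => (1 / ‖(1 / ‖x i‖ ^ 2) • x i + a‖ ^ 2) • ((1 / ‖x i‖ ^ 2) • x i + a)) =
      fun i => (1 + 2 * inner ℝ a (x i) + ‖a‖ ^ 2 * ‖x i‖ ^ 2)⁻¹ • (x i + ‖x i‖ ^ 2 • a) :=
    funext fun i => sctA_inv_inv_add (hx0 i) (hσne i)
  have e2 : (∏ j, (‖(1 / ‖x j‖ ^ 2) • x j + a‖ ^ 2) ^ (-Δ)) =
      (∏ j, (1 + 2 * inner ℝ a (x j) + ‖a‖ ^ 2 * ‖x j‖ ^ 2) ^ Δ)⁻¹ * ∏ j, (1 / ‖x j‖ ^ 2) ^ (-Δ) := by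
    rw [← Finset.prod_inv_distrib, ← Finset.prod_mul_distrib]
    refine Finset.prod_congr rfl fun j _ => ?_
    rw [show ‖(1 / ‖x j‖ ^ 2) • x j + a‖ ^ 2 =
        (1 + 2 * inner ℝ a (x j) + ‖a‖ ^ 2 * ‖x j‖ ^ 2) / ‖x j‖ ^ 2 by simpa using hnormsq j 1]
    exact sctB_rpow_bookkeeping (hσpos j) (hr j)
  have e3 : (∏ j, (‖(1 / ‖x j‖ ^ 2) • x j‖ ^ 2) ^ (-Δ)) = ∏ j, (1 / ‖x j‖ ^ 2) ^ (-Δ) := by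
    refine Finset.prod_congr rfl fun j _ => ?_
    rw [norm_sphereInversion one_pos (hx0 j), div_pow, one_pow]
  rw [e1, e2, e3, sctA_prodInv_prodInv hx0] at key
  -- cancel the common positive factor
  have hw : (∏ j, (1 / ‖x j‖ ^ 2) ^ (-Δ)) ≠ 0 :=
    Finset.prod_ne_zero_iff.2 fun j _ => (Real.rpow_pos_of_pos (one_div_pos.2 (hr j)) _).ne'
  have hPne : (∏ j, (1 + 2 * inner ℝ a (x j) + ‖a‖ ^ 2 * ‖x j‖ ^ 2) ^ Δ) ≠ 0 :=
    Finset.prod_ne_zero_iff.2 fun j _ => (Real.rpow_pos_of_pos (hσpos j) _).ne'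
  set P : ℝ := ∏ j, (1 + 2 * inner ℝ a (x j) + ‖a‖ ^ 2 * ‖x j‖ ^ 2) ^ Δ with hPdef
  set W : ℝ := ∏ j, (1 / ‖x j‖ ^ 2) ^ (-Δ) with hWdef
  set A : ℝ := S n (fun i => (1 + 2 * inner ℝ a (x i) + ‖a‖ ^ 2 * ‖x i‖ ^ 2)⁻¹ • (x i + ‖x i‖ ^ 2 • a))
    with hAdef
  have h1 : A = P * ((P⁻¹ * W) * A) / W := by field_simp
  rw [h1, key]
  field_simp

end Summit.CriticalPhenomena.Ising3DConformalLimit.PrecisionLaplacianMoebiusLimitOfTwoPointLaw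

end
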